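import Mathlib
import Summits.ValiantsHypothesis.ValiantsHypothesis.Theorems.LacunarySymmetroidMatrixDescartesDominantMiddle
import Summits.ValiantsHypothesis.ValiantsHypothesis.Theorems.LacunarySymmetroidMatrixDescartesCensusFatSectors

/-!
# `MatrixDescartes` (stmt-ValiantsHypothesis-18050) — the dominant-middle law in the crux's currency

HONEST FRAMING.  Cell `pub-symmetroid`, seat `val-sym-mdr-p2` (gen 4); helper file `--supports` the crux
`Theses.LacunarySymmetroid.MatrixDescartes`.  Bookkeeping corollaries of the SECTOR theorem `dominantMiddle`
(`…DominantMiddle`: `(+)(−)(+)` semidefinite blocks with a negative block dominating at one scale ⇒ `Z₊ ≤ 2·card ι`):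
nothing here bears on the crux in general, on `stub_twoSided`, on `DoorA26` / `DoorA34`, or on `VP ≠ VNP`.

* `dominantMiddle_realRoots_le`: if `F(X) = ∑ₗ X^{dₗ} Sₗ` (real symmetric `m × m` letters, `K` terms, strictly
  increasing exponents) and the reflected pencil `F(−X) = ∑ₗ X^{dₗ}((−1)^{dₗ}Sₗ)` are both dominant-middle words
  (blocks `h < μ, μ' < τ` resp. `h' < ν, ν' < τ'`, scales `x₁, x₁'`), then `det F` has at most `4m + 1` distinct real
  zeros (tree `stub_negRoots`).
* `dominantMiddle_mdr`: in the regime `m ≤ 2^((⌊log₂K⌋+c)^c)` this gives `Z^q ≤ 2^(K⌊log₂K⌋)` for all large `K`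
  (tree `Census.fatFormat_absorb`) — the inequality of `MatrixDescartes` on this format family at every admissible
  size, fat formats included.  Nothing is claimed outside the family.
[folklore] Mathlib + tree lemmas; axioms `propext`, `Classical.choice`, `Quot.sound`.
-/

-- layout Summits/ValiantsHypothesis/ValiantsHypothesis forces the duplicated namespace component
set_option linter.dupNamespace false

namespace Summit.ValiantsHypothesis.ValiantsHypothesis.Theorems.LacunarySymmetroidMatrixDescartes

open Polynomial Matrix Finset
open scoped BigOperators

/-- **Real zeros of a two-way dominant-middle word**: if `F(X)` and `F(−X)` are both dominant-middle words (real
symmetric `m × m` letters at strictly increasing exponents, `K` terms), `det F` has at most `4m + 1` distinct real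
zeros. [folklore] -/
theorem dominantMiddle_realRoots_le (K m : ℕ) (d : Fin K → ℕ) (hd : StrictMono d)
    (S : Fin K → Matrix (Fin m) (Fin m) ℝ) (hS : ∀ l, (S l).IsSymm)
    -- the word `F(X)`
    (h μ μ' τ : Fin K) (hhμ : h < μ) (hμτ : μ < τ) (hhμ' : h < μ') (hμ'τ : μ' < τ)
    (hhead : ∀ l, l ≤ h → (S l).PosSemidef) (hmid : ∀ l, h < l → l < τ → (-S l).PosSemidef)
    (htail : ∀ l, τ ≤ l → (S l).PosSemidef) (x₁ : ℝ) (hx₁ : 0 < x₁)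
    (hdom₁ : ((((d μ - d h : ℕ) : ℝ)) • (-S μ)
      - ∑ l ∈ univ.filter (fun l => τ ≤ l), (((d l - d h : ℕ) : ℝ) * x₁ ^ (d l - d μ)) • S l).PosSemidef)
    (hdom₂ : ((((d τ - d μ' : ℕ) : ℝ)) • (-S μ')
      - ∑ l ∈ univ.filter (fun l => l ≤ h), (((d τ - d l : ℕ) : ℝ) * (x₁⁻¹) ^ (d μ' - d l)) • S l
        ).PosSemidef)
    -- the reflected word `F(−X)`
    (h' ν ν' τ' : Fin K) (hhν : h' < ν) (hντ : ν < τ') (hhν' : h' < ν') (hν'τ : ν' < τ')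
    (hhead' : ∀ l, l ≤ h' → (((-1 : ℝ) ^ d l) • S l).PosSemidef)
    (hmid' : ∀ l, h' < l → l < τ' → (-(((-1 : ℝ) ^ d l) • S l)).PosSemidef)
    (htail' : ∀ l, τ' ≤ l → (((-1 : ℝ) ^ d l) • S l).PosSemidef) (x₁' : ℝ) (hx₁' : 0 < x₁')
    (hdom₁' : ((((d ν - d h' : ℕ) : ℝ)) • (-(((-1 : ℝ) ^ d ν) • S ν))
      - ∑ l ∈ univ.filter (fun l => τ' ≤ l),
          (((d l - d h' : ℕ) : ℝ) * x₁' ^ (d l - d ν)) • (((-1 : ℝ) ^ d l) • S l)).PosSemidef)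
    (hdom₂' : ((((d τ' - d ν' : ℕ) : ℝ)) • (-(((-1 : ℝ) ^ d ν') • S ν'))
      - ∑ l ∈ univ.filter (fun l => l ≤ h'),
          (((d τ' - d l : ℕ) : ℝ) * (x₁'⁻¹) ^ (d ν' - d l)) • (((-1 : ℝ) ^ d l) • S l)).PosSemidef) :
    (Matrix.det (∑ l, ((Polynomial.X : Polynomial ℝ) ^ d l) • (S l).map Polynomial.C)
      ).roots.toFinset.card ≤ 4 * m + 1 := by
  have h1 := dominantMiddle (Fin m) K d hd S hS h μ μ' τ hhμ hμτ hhμ' hμ'τ hhead hmid htail x₁ hx₁ hdom₁ hdom₂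
  have h2 := dominantMiddle (Fin m) K d hd (fun l => ((-1 : ℝ) ^ d l) • S l) (fun l => (hS l).smul _)
    h' ν ν' τ' hhν hντ hhν' hν'τ hhead' hmid' htail' x₁' hx₁' hdom₁' hdom₂'
  have h3 := stub_negRoots K m d S
  rw [Fintype.card_fin] at h1 h2
  omega

/-- **The crux's inequality on two-way dominant-middle words, at every admissible size.**  For all `c, q` there is
`K₀` such that for all `K ≥ K₀`, all `m ≤ 2^((⌊log₂K⌋+c)^c)`, all strictly increasing exponents and all real symmetric
letters for which `F(X)` and `F(−X)` are dominant-middle words (data as in `dominantMiddle_realRoots_le`), the number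
`Z` of distinct real zeros of `det (∑ₗ X^{dₗ} Sₗ)` satisfies `Z^q ≤ 2^(K⌊log₂K⌋)` — `MatrixDescartes` restricted to this
format family, fat formats included.  Nothing is claimed outside the family. [folklore] -/
theorem dominantMiddle_mdr (c q : ℕ) : ∃ K₀ : ℕ, ∀ K m : ℕ, K₀ ≤ K →
    m ≤ 2 ^ ((Nat.log 2 K + c) ^ c) → ∀ (d : Fin K → ℕ), StrictMono d →
    ∀ (S : Fin K → Matrix (Fin m) (Fin m) ℝ), (∀ l, (S l).IsSymm) →
    ∀ (h μ μ' τ : Fin K), h < μ → μ < τ → h < μ' → μ' < τ →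
    (∀ l, l ≤ h → (S l).PosSemidef) → (∀ l, h < l → l < τ → (-S l).PosSemidef) →
    (∀ l, τ ≤ l → (S l).PosSemidef) → ∀ (x₁ : ℝ), 0 < x₁ →
    ((((d μ - d h : ℕ) : ℝ)) • (-S μ)
      - ∑ l ∈ univ.filter (fun l => τ ≤ l), (((d l - d h : ℕ) : ℝ) * x₁ ^ (d l - d μ)) • S l).PosSemidef →
    ((((d τ - d μ' : ℕ) : ℝ)) • (-S μ')
      - ∑ l ∈ univ.filter (fun l => l ≤ h), (((d τ - d l : ℕ) : ℝ) * (x₁⁻¹) ^ (d μ' - d l)) • S l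
        ).PosSemidef →
    ∀ (h' ν ν' τ' : Fin K), h' < ν → ν < τ' → h' < ν' → ν' < τ' →
    (∀ l, l ≤ h' → (((-1 : ℝ) ^ d l) • S l).PosSemidef) →
    (∀ l, h' < l → l < τ' → (-(((-1 : ℝ) ^ d l) • S l)).PosSemidef) →
    (∀ l, τ' ≤ l → (((-1 : ℝ) ^ d l) • S l).PosSemidef) → ∀ (x₁' : ℝ), 0 < x₁' →
    ((((d ν - d h' : ℕ) : ℝ)) • (-(((-1 : ℝ) ^ d ν) • S ν))
      - ∑ l ∈ univ.filter (fun l => τ' ≤ l),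
          (((d l - d h' : ℕ) : ℝ) * x₁' ^ (d l - d ν)) • (((-1 : ℝ) ^ d l) • S l)).PosSemidef →
    ((((d τ' - d ν' : ℕ) : ℝ)) • (-(((-1 : ℝ) ^ d ν') • S ν'))
      - ∑ l ∈ univ.filter (fun l => l ≤ h'),
          (((d τ' - d l : ℕ) : ℝ) * (x₁'⁻¹) ^ (d ν' - d l)) • (((-1 : ℝ) ^ d l) • S l)).PosSemidef →
    (Matrix.det (∑ l, ((Polynomial.X : Polynomial ℝ) ^ d l) • (S l).map Polynomial.C)
      ).roots.toFinset.card ^ q ≤ 2 ^ (K * Nat.log 2 K) := by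
  obtain ⟨K₀, hK₀⟩ := Census.fatFormat_absorb 2 c q
  refine ⟨K₀, fun K m hK hm d hd S hS h μ μ' τ hhμ hμτ hhμ' hμ'τ hhead hmid htail x₁ hx₁ hdom₁ hdom₂
    h' ν ν' τ' hhν hντ hhν' hν'τ hhead' hmid' htail' x₁' hx₁' hdom₁' hdom₂' => hK₀ K m _ hK hm ?_⟩
  have hZ := dominantMiddle_realRoots_le K m d hd S hS h μ μ' τ hhμ hμτ hhμ' hμ'τ hhead hmid htail x₁ hx₁
    hdom₁ hdom₂ h' ν ν' τ' hhν hντ hhν' hν'τ hhead' hmid' htail' x₁' hx₁' hdom₁' hdom₂'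
  have h4 : 4 * m + 1 ≤ 2 ^ 2 * (m + 1) * (K + 1) := by nlinarith
  exact hZ.trans h4

end Summit.ValiantsHypothesis.ValiantsHypothesis.Theorems.LacunarySymmetroidMatrixDescartes
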